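import Summits.Ventures.CertifiedManyBodySolver.Theses.CovHg1201M19P10

/-!
# Theorems/CovHg1201M19P10Assembly.lean — route «CovHg1201M19P10» (hubbard-cov-hg1201 @ 10 GPa), item `Assembly` (stmt-Ventures-27106)

`Assembly := PatchLeftEdgeP10 → PatchBottomP10 → Hg1201M19P10_StiffnessBoxCeiling` is the curried form of the route file's gate-written deciding theorem
`closes` (= `Observables.Hg1201M19P10_StiffnessBoxCeiling_of_cornerPatch le_rfl` (box-2 p611355) ∘ `ObsStiffnessSeqCeilingAt_on_box_of_bottomEdge_and_leftEdge_targetSlot`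
with `(p, q, U_A, U_max) = (−49/100, −47/100, 3, 17/2)`, values `−c`, prices trivial). Captain hubbard-cov-hg1201-plan-1 CAPTAIN ACK 2026-08-28T09:03:14Z:
«27106 ← anyone idle, ONE writer»; filed by hubbard-cov-hg1201-box-2. Nothing about the two cruxes is claimed: the theorem is an implication, CONDITIONAL on
them by construction, exactly as the item is typed.
HONEST FRAMING: glue only — certified stiffness CEILINGS on a downfolded SCREENING-GRADE box at P = 10 GPa are CONTROL / CALIBRATION + labelled heuristic
(wording class (xx1)); a ceiling never speaks to the presence of superconductivity; not a `T_c`, phase or `dT_c/dP` statement; no rung leaf and no summit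
statement is proved by this file.
-/

namespace Summit.Ventures.CertifiedManyBodySolver.Theorems

open Summit.Ventures.CertifiedManyBodySolver.Theses.CovHg1201M19P10

/-- **Item `Assembly` of route `CovHg1201M19P10`** (stmt-Ventures-27106): the left-edge bundle and the bottom bundle of the P10 residual corner patch give the
registered rung leaf «MOS2-hg1201-M19P10» — by the route file's deciding theorem `closes`. [cite: ScalapinoWhiteZhang1993, §II] [cite: KomaTasaki1994, §1] -/
theorem covHg1201M19P10Assembly_proof : Assembly := by
  unfold Assembly
  exact fun h₁ h₂ => closes h₁ h₂

end Summit.Ventures.CertifiedManyBodySolver.Theorems
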